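import Literature.Analysis.SpecialFunctions.LaguerrePolynomial
import Mathlib.Analysis.SpecialFunctions.Gamma.Basic
import Mathlib.Algebra.Group.ForwardDiff
import Mathlib.MeasureTheory.Integral.Bochner.Basic
import Mathlib.Topology.Algebra.Polynomial
import HarnessLib

/-!
# Orthonormality of the classical Laguerre polynomials and Bessel's inequality on `(0, ∞)`

RH-FREE real analysis (support for [AriasDeReyna2011KeiperLi] Cor 5.1).  For the classical Laguerre
polynomials `L_n = laguerre 0 n` (`LaguerrePolynomial.lean`; `L_n(t) = Σ_j C(n,j)(−t)ʲ/j!`, `laguerreCoeff_zero`) we prove the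
orthonormality relation of Szegő (5.1.1) at `α = 0`,

  `∫₀^∞ L_m(t) L_n(t) e^{−t} dt = [m = n]`   (`integral_laguerre_mul_laguerre_mul_exp_neg`),

through the moments `∫₀^∞ tᵏ L_n(t) e^{−t} dt = 0` (`k < n`), `= (−1)ⁿ n!` (`k = n`) — the alternating sums
`Σ_j (−1)ʲ C(n,j) C(k+j,k)` are `n`-th forward differences of `x ↦ C(x,k)` (Mathlib's `fwdDiff_iter_choose`) —
and Bessel's inequality for the orthonormal system of Laguerre functions `ℓ_n(t) = L_n(t) e^{−t/2}` on
`L²(0,∞)`, by hand (`sum_sq_integral_mul_laguerreFn_le`, `summable_sq_integral_mul_laguerreFn`).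

## References
* [Szego1975] G. Szegő, *Orthogonal Polynomials*, 4th ed. (1975), §5.1, (5.1.1) (orthogonality,
  `∫₀^∞ e^{−x} xᵅ L_m^{(α)} L_n^{(α)} dx = Γ(α+1) C(n+α,n) δ_{mn}`), (5.1.6).
* [AriasDeReyna2011KeiperLi] J. Arias de Reyna, Funct. Approx. Comment. Math. 45 (2011) 7–21, proof of
  Cor 5.1 p.17 (Laguerre expansion in `L²(0,∞)`).
-/

noncomputable section

open Real Set MeasureTheory Finset Polynomial Filter
open scoped Nat fwdDiff

namespace Literature.Analysis.SpecialFunctions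

namespace LaguerreOrthogonality

/-! ### Coefficients at `α = 0` -/

/-- `[tʲ]L_n = (−1)ʲ C(n,j)/j!` (`j ≤ n`). [cite: Szego1975, (5.1.6)] -/
theorem laguerreCoeff_zero (n j : ℕ) (hj : j ≤ n) :
    laguerreCoeff 0 n j = (-1) ^ j * (n.choose j : ℝ) / (j ! : ℝ) := by
  rw [laguerreCoeff]
  have hP : (ascPochhammer ℝ (n - j)).eval ((0 : ℝ) + j + 1) = ((n)! : ℝ) / (j ! : ℝ) := by
    have h1 : ((0 : ℝ) + j + 1) = ((j + 1 : ℕ) : ℝ) := by push_cast; ring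
    rw [h1, ← ascPochhammer_eval_cast, ascPochhammer_nat_eq_ascFactorial]
    have h2 : (j ! : ℝ) * ((j + 1).ascFactorial (n - j) : ℝ) = (n ! : ℝ) := by
      have := Nat.factorial_mul_ascFactorial j (n - j)
      rw [Nat.add_sub_cancel' hj] at this
      exact_mod_cast this
    have hj0 : (j ! : ℝ) ≠ 0 := by positivity
    field_simp
    linear_combination h2
  rw [hP]
  have hc : (n.choose j : ℝ) = (n ! : ℝ) / ((j ! : ℝ) * ((n - j)! : ℝ)) := by
    have := Nat.choose_mul_factorial_mul_factorial hj
    have h1 : (j ! : ℝ) ≠ 0 := by positivity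
    have h2 : ((n - j)! : ℝ) ≠ 0 := by positivity
    field_simp
    exact_mod_cast this
  rw [hc]
  have h1 : (j ! : ℝ) ≠ 0 := by positivity
  have h2 : ((n - j)! : ℝ) ≠ 0 := by positivity
  field_simp

/-! ### Moments against `e^{−t}` -/

/-- `∫₀^∞ tʲ e^{−t} dt = j!`. [folklore] -/
private theorem integral_pow_mul_exp_neg (j : ℕ) :
    ∫ t in Ioi (0 : ℝ), t ^ j * Real.exp (-t) = (j ! : ℝ) := by
  rw [← Real.Gamma_nat_eq_factorial, Real.Gamma_eq_integral (by positivity)]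
  refine setIntegral_congr_fun measurableSet_Ioi fun t (ht : 0 < t) ↦ ?_
  rw [show ((j : ℝ) + 1 - 1) = (j : ℕ) by ring, Real.rpow_natCast, mul_comm]

/-- Integrability of `tʲ e^{−t}` on `(0, ∞)`. [folklore] -/
private theorem integrableOn_pow_mul_exp_neg (j : ℕ) :
    IntegrableOn (fun t : ℝ ↦ t ^ j * Real.exp (-t)) (Ioi 0) := by
  refine Integrable.of_integral_ne_zero ?_
  rw [integral_pow_mul_exp_neg]
  positivity

/-- Integrability of `tᵏ L_n(t) e^{−t}` on `(0,∞)`. [cite: Szego1975, (5.1.1)] -/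
theorem integrableOn_pow_mul_laguerre_mul_exp_neg (k n : ℕ) :
    IntegrableOn (fun t : ℝ ↦ t ^ k * (laguerre 0 n).eval t * Real.exp (-t)) (Ioi 0) := by
  have e : (fun t : ℝ ↦ t ^ k * (laguerre 0 n).eval t * Real.exp (-t)) = fun t ↦
      ∑ j ∈ range (n + 1), (-1) ^ j * (n.choose j : ℝ) / (j ! : ℝ) * (t ^ (k + j) * Real.exp (-t)) := by
    funext t
    rw [eval_laguerre, Finset.mul_sum, Finset.sum_mul]
    refine Finset.sum_congr rfl fun j hj ↦ ?_
    rw [laguerreCoeff_zero n j (Nat.lt_succ_iff.mp (Finset.mem_range.mp hj)), pow_add]; ring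
  rw [e]
  exact integrable_finsetSum _ fun j _ ↦ (integrableOn_pow_mul_exp_neg (k + j)).const_mul _

/-- The alternating binomial sum behind the Laguerre moments: for `k ≤ n`,
`Σ_{j ≤ n} (−1)ʲ C(n,j) C(k+j,k) = (−1)ⁿ [k = n]` (an `n`-th forward difference of `x ↦ C(x,k)` at `x = k`).
[folklore] -/
private theorem sum_neg_one_pow_mul_choose_mul_choose {k n : ℕ} (hk : k ≤ n) :
    ∑ j ∈ range (n + 1), (-1 : ℤ) ^ j * (n.choose j : ℤ) * ((k + j).choose k : ℤ) =
      if k = n then (-1) ^ n else 0 := by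
  -- `Δ^[n] (x ↦ C(x,k)) k = Σ_j (−1)^{n−j} C(n,j) C(k+j,k)`
  have hsum := fwdDiff_iter_eq_sum_shift (h := (1 : ℕ)) (fun x : ℕ ↦ (x.choose k : ℤ)) n k
  simp only [smul_eq_mul, mul_one] at hsum
  -- value of the iterated difference
  have hval : Δ_[1]^[n] (fun x : ℕ ↦ (x.choose k : ℤ)) k = if k = n then 1 else 0 := by
    rcases eq_or_lt_of_le hk with rfl | hlt
    · have h := fwdDiff_iter_choose 0 k
      rw [add_zero] at h
      rw [h, if_pos rfl]
      simp
    · rw [if_neg hlt.ne]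
      obtain ⟨m, rfl⟩ := Nat.exists_eq_add_of_lt hlt
      -- `Δ^[k+m+1] = Δ^[m] ∘ Δ ∘ Δ^[k]`, and `Δ^[k] C(·,k) = 1`, `Δ 1 = 0`
      have h := fwdDiff_iter_choose 0 k
      rw [add_zero] at h
      rw [show k + m + 1 = (m + 1) + k by ring, Function.iterate_add_apply, h]
      simp only [Nat.choose_zero_right, Nat.cast_one]
      rw [Function.iterate_succ_apply, fwdDiff_const]
      have h0 : ∀ i : ℕ, Δ_[1]^[i] (fun _ : ℕ ↦ (0 : ℤ)) = fun _ ↦ 0 := by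
        intro i
        induction i with
        | zero => rfl
        | succ i ih => rw [Function.iterate_succ_apply', ih, fwdDiff_const]
      rw [h0]
  rw [hval] at hsum
  -- convert `(−1)^{n−j}` to `(−1)^n (−1)^j`
  have hconv : ∑ j ∈ range (n + 1), (-1 : ℤ) ^ j * (n.choose j : ℤ) * ((k + j).choose k : ℤ) =
      (-1) ^ n * ∑ j ∈ range (n + 1), (-1 : ℤ) ^ (n - j) * (n.choose j : ℤ) * ((k + j).choose k : ℤ) := by
    rw [Finset.mul_sum]
    refine Finset.sum_congr rfl fun j hj ↦ ?_
    have hjn : j ≤ n := Nat.lt_succ_iff.mp (Finset.mem_range.mp hj)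
    have : (-1 : ℤ) ^ j = (-1) ^ n * (-1) ^ (n - j) := by
      rw [← pow_add, show n + (n - j) = j + 2 * (n - j) by omega, pow_add, pow_mul]
      simp
    rw [this]; ring
  rw [hconv, ← hsum]
  split_ifs with h
  · simp
  · simp

/-- **Moments**: for `k ≤ n`, `∫₀^∞ tᵏ L_n(t) e^{−t} dt = (−1)ⁿ n!` if `k = n` and `0` if `k < n`.
[cite: Szego1975, (5.1.1)] -/
theorem integral_pow_mul_laguerre_mul_exp_neg {k n : ℕ} (hk : k ≤ n) :
    ∫ t in Ioi (0 : ℝ), t ^ k * (laguerre 0 n).eval t * Real.exp (-t) =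
      if k = n then (-1) ^ n * (n ! : ℝ) else 0 := by
  have e : (fun t : ℝ ↦ t ^ k * (laguerre 0 n).eval t * Real.exp (-t)) = fun t ↦
      ∑ j ∈ range (n + 1), (-1) ^ j * (n.choose j : ℝ) / (j ! : ℝ) * (t ^ (k + j) * Real.exp (-t)) := by
    funext t
    rw [eval_laguerre, Finset.mul_sum, Finset.sum_mul]
    refine Finset.sum_congr rfl fun j hj ↦ ?_
    rw [laguerreCoeff_zero n j (Nat.lt_succ_iff.mp (Finset.mem_range.mp hj)), pow_add]; ring
  rw [e, integral_finsetSum _ fun j _ ↦ (integrableOn_pow_mul_exp_neg (k + j)).const_mul _]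
  simp_rw [integral_const_mul, integral_pow_mul_exp_neg]
  -- `(k+j)!/j! = k! C(k+j,k)`
  have hterm : ∀ j ∈ range (n + 1), (-1 : ℝ) ^ j * (n.choose j : ℝ) / (j ! : ℝ) * ((k + j)! : ℝ) =
      (k ! : ℝ) * (((-1 : ℤ) ^ j * (n.choose j : ℤ) * ((k + j).choose k : ℤ) : ℤ) : ℝ) := by
    intro j _
    have h := Nat.choose_mul_factorial_mul_factorial (Nat.le_add_right k j)
    rw [Nat.add_sub_cancel_left] at h
    have hj : (j ! : ℝ) ≠ 0 := by positivity
    have h' : (((k + j).choose k : ℝ) * (k ! : ℝ) * (j ! : ℝ)) = ((k + j)! : ℝ) := by exact_mod_cast h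
    push_cast
    rw [← h']
    field_simp
  rw [Finset.sum_congr rfl hterm, ← Finset.mul_sum]
  have hz := sum_neg_one_pow_mul_choose_mul_choose hk
  rw [← Int.cast_sum, hz]
  split_ifs with h
  · subst h; push_cast; ring
  · simp

/-- **Orthonormality of the Laguerre polynomials** (Szegő (5.1.1), `α = 0`):
`∫₀^∞ L_m(t) L_n(t) e^{−t} dt = 1` if `m = n`, `0` otherwise. [cite: Szego1975, (5.1.1)] -/
theorem integral_laguerre_mul_laguerre_mul_exp_neg (m n : ℕ) :
    ∫ t in Ioi (0 : ℝ), (laguerre 0 m).eval t * (laguerre 0 n).eval t * Real.exp (-t) =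
      if m = n then 1 else 0 := by
  -- we may assume `m ≤ n`
  wlog hmn : m ≤ n generalizing m n
  · have h := this n m (le_of_not_ge hmn)
    rw [if_neg (fun h' ↦ hmn (le_of_eq h'))]
    rw [if_neg (fun h' ↦ hmn (ge_of_eq h'))] at h
    refine Eq.trans ?_ h
    refine setIntegral_congr_fun measurableSet_Ioi fun t _ ↦ ?_
    ring
  -- expand `L_m` in monomials
  have e : (fun t : ℝ ↦ (laguerre 0 m).eval t * (laguerre 0 n).eval t * Real.exp (-t)) = fun t ↦
      ∑ k ∈ range (m + 1), (-1) ^ k * (m.choose k : ℝ) / (k ! : ℝ) *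
        (t ^ k * (laguerre 0 n).eval t * Real.exp (-t)) := by
    funext t
    rw [eval_laguerre 0 m, Finset.sum_mul, Finset.sum_mul]
    refine Finset.sum_congr rfl fun k hk ↦ ?_
    rw [laguerreCoeff_zero m k (Nat.lt_succ_iff.mp (Finset.mem_range.mp hk))]
    ring
  rw [e, integral_finsetSum _ fun k _ ↦ (integrableOn_pow_mul_laguerre_mul_exp_neg k n).const_mul _]
  simp_rw [integral_const_mul]
  have hterm : ∀ k ∈ range (m + 1), (-1 : ℝ) ^ k * (m.choose k : ℝ) / (k ! : ℝ) *
      (∫ t in Ioi (0 : ℝ), t ^ k * (laguerre 0 n).eval t * Real.exp (-t)) =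
      if k = n then 1 else 0 := by
    intro k hk
    have hkm : k ≤ m := Nat.lt_succ_iff.mp (Finset.mem_range.mp hk)
    rw [integral_pow_mul_laguerre_mul_exp_neg (hkm.trans hmn)]
    split_ifs with h
    · subst h
      have hmn' : m = k := le_antisymm hmn hkm
      subst hmn'
      rw [Nat.choose_self, Nat.cast_one, mul_one]
      have h1 : ((-1 : ℝ) ^ m * (-1) ^ m) = 1 := by rw [← pow_add, ← two_mul, pow_mul]; norm_num
      have : (m ! : ℝ) ≠ 0 := by positivity
      calc (-1 : ℝ) ^ m / (m ! : ℝ) * ((-1) ^ m * (m ! : ℝ))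
          = ((-1 : ℝ) ^ m * (-1) ^ m) * ((m ! : ℝ) / (m ! : ℝ)) := by ring
        _ = 1 := by rw [h1, div_self this, one_mul]
    · simp
  rw [Finset.sum_congr rfl hterm, Finset.sum_ite_eq' (range (m + 1)) n (fun _ ↦ (1 : ℝ))]
  by_cases h : m = n
  · subst h; simp
  · rw [if_neg h, if_neg]
    simp only [Finset.mem_range, not_lt]
    omega

/-! ### The Laguerre functions and Bessel's inequality -/

/-- The Laguerre functions `ℓ_n(t) = L_n(t) e^{−t/2}`, an orthonormal system in `L²(0,∞)`.
[cite: Szego1975, (5.1.1)] -/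
def laguerreFn (n : ℕ) (t : ℝ) : ℝ := (laguerre 0 n).eval t * Real.exp (-t / 2)

/-- `ℓ_n` is continuous. [cite: Szego1975, (5.1.1)] -/
theorem continuous_laguerreFn (n : ℕ) : Continuous (laguerreFn n) :=
  ((laguerre 0 n).continuous).mul (by fun_prop)

/-- `ℓ_m ℓ_n = L_m L_n e^{−t}`. [cite: Szego1975, (5.1.1)] -/
theorem laguerreFn_mul_laguerreFn (m n : ℕ) (t : ℝ) :
    laguerreFn m t * laguerreFn n t = (laguerre 0 m).eval t * (laguerre 0 n).eval t * Real.exp (-t) := by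
  simp only [laguerreFn]
  have : Real.exp (-t / 2) * Real.exp (-t / 2) = Real.exp (-t) := by
    rw [← Real.exp_add]; ring_nf
  calc (laguerre 0 m).eval t * Real.exp (-t / 2) * ((laguerre 0 n).eval t * Real.exp (-t / 2))
      = (laguerre 0 m).eval t * (laguerre 0 n).eval t * (Real.exp (-t / 2) * Real.exp (-t / 2)) := by ring
    _ = _ := by rw [this]

/-- Orthonormality of `(ℓ_n)`: `∫₀^∞ ℓ_m ℓ_n = [m = n]`. [cite: Szego1975, (5.1.1)] -/
theorem integral_laguerreFn_mul_laguerreFn (m n : ℕ) :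
    ∫ t in Ioi (0 : ℝ), laguerreFn m t * laguerreFn n t = if m = n then 1 else 0 := by
  simp_rw [laguerreFn_mul_laguerreFn]
  exact integral_laguerre_mul_laguerre_mul_exp_neg m n

/-- Integrability of `ℓ_m ℓ_n` on `(0,∞)`. [cite: Szego1975, (5.1.1)] -/
theorem integrableOn_laguerreFn_mul_laguerreFn (m n : ℕ) :
    IntegrableOn (fun t ↦ laguerreFn m t * laguerreFn n t) (Ioi 0) := by
  simp_rw [laguerreFn_mul_laguerreFn]
  have h := integrableOn_pow_mul_laguerre_mul_exp_neg 0 n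
  have e : (fun t : ℝ ↦ (laguerre 0 m).eval t * (laguerre 0 n).eval t * Real.exp (-t)) = fun t ↦
      ∑ k ∈ range (m + 1), (-1) ^ k * (m.choose k : ℝ) / (k ! : ℝ) *
        (t ^ k * (laguerre 0 n).eval t * Real.exp (-t)) := by
    funext t
    rw [eval_laguerre 0 m, Finset.sum_mul, Finset.sum_mul]
    refine Finset.sum_congr rfl fun k hk ↦ ?_
    rw [laguerreCoeff_zero m k (Nat.lt_succ_iff.mp (Finset.mem_range.mp hk))]
    ring
  rw [e]
  exact integrable_finsetSum _ fun k _ ↦ (integrableOn_pow_mul_laguerre_mul_exp_neg k n).const_mul _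

/-- If `h` is (a.e. strongly) measurable and `h² ∈ L¹(0,∞)`, then `h ℓ_n ∈ L¹(0,∞)` (`2|hℓ| ≤ h² + ℓ²`).
[cite: AriasDeReyna2011KeiperLi, proof of Cor. 5.1 p.17] -/
theorem integrableOn_mul_laguerreFn {h : ℝ → ℝ} (hm : AEStronglyMeasurable h (volume.restrict (Ioi 0)))
    (h2 : IntegrableOn (fun t ↦ h t ^ 2) (Ioi 0)) (n : ℕ) :
    IntegrableOn (fun t ↦ h t * laguerreFn n t) (Ioi 0) := by
  have hb : IntegrableOn (fun t ↦ (h t ^ 2 + laguerreFn n t * laguerreFn n t) / 2) (Ioi 0) :=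
    (h2.add (integrableOn_laguerreFn_mul_laguerreFn n n)).div_const 2
  refine Integrable.mono' hb (hm.mul (continuous_laguerreFn n).aestronglyMeasurable.restrict) ?_
  refine Eventually.of_forall fun t ↦ ?_
  rw [Real.norm_eq_abs, abs_mul]
  have := two_mul_le_add_sq |h t| |laguerreFn n t|
  rw [sq_abs, sq_abs] at this
  rw [sq] at this ⊢
  have e : |laguerreFn n t| * |laguerreFn n t| = laguerreFn n t * laguerreFn n t := abs_mul_abs_self _
  linarith

/-- **Bessel's inequality for the Laguerre functions on `(0,∞)`**: for `h` measurable with `h² ∈ L¹(0,∞)`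
and every `N`, `Σ_{n<N} (∫₀^∞ h ℓ_n)² ≤ ∫₀^∞ h²`.  By hand: with `c_n = ∫ h ℓ_n` and `P = Σ_{n<N} c_n ℓ_n`,
`0 ≤ ∫(h − P)² = ∫h² − Σ c_n²`. [cite: AriasDeReyna2011KeiperLi, proof of Cor. 5.1 p.17] -/
theorem sum_sq_integral_mul_laguerreFn_le {h : ℝ → ℝ} (hm : AEStronglyMeasurable h (volume.restrict (Ioi 0)))
    (h2 : IntegrableOn (fun t ↦ h t ^ 2) (Ioi 0)) (N : ℕ) :
    ∑ n ∈ range N, (∫ t in Ioi (0 : ℝ), h t * laguerreFn n t) ^ 2 ≤ ∫ t in Ioi (0 : ℝ), h t ^ 2 := by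
  set c : ℕ → ℝ := fun n ↦ ∫ t in Ioi (0 : ℝ), h t * laguerreFn n t with hc
  set P : ℝ → ℝ := fun t ↦ ∑ n ∈ range N, c n * laguerreFn n t with hP
  set S : ℝ := ∑ n ∈ range N, c n ^ 2 with hS
  have hhl : ∀ n, IntegrableOn (fun t ↦ h t * laguerreFn n t) (Ioi 0) :=
    fun n ↦ integrableOn_mul_laguerreFn hm h2 n
  -- (1) `∫ h·P = S`
  have hhP : IntegrableOn (fun t ↦ h t * P t) (Ioi 0) := by
    have e : (fun t ↦ h t * P t) = fun t ↦ ∑ n ∈ range N, c n * (h t * laguerreFn n t) := by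
      funext t; simp only [hP]; rw [Finset.mul_sum]
      exact Finset.sum_congr rfl fun n _ ↦ by ring
    rw [e]; exact integrable_finsetSum _ fun n _ ↦ (hhl n).const_mul _
  have h1 : ∫ t in Ioi (0 : ℝ), h t * P t = S := by
    have e : (fun t ↦ h t * P t) = fun t ↦ ∑ n ∈ range N, c n * (h t * laguerreFn n t) := by
      funext t; simp only [hP]; rw [Finset.mul_sum]
      exact Finset.sum_congr rfl fun n _ ↦ by ring
    rw [e, integral_finsetSum _ fun n _ ↦ (hhl n).const_mul _]
    refine Finset.sum_congr rfl fun n _ ↦ ?_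
    rw [integral_const_mul]
    simp only [hc]; ring
  -- (2) `∫ P² = S`
  have hPP : ∀ n, IntegrableOn (fun t ↦ ∑ m ∈ range N, c n * c m * (laguerreFn n t * laguerreFn m t))
      (Ioi 0) :=
    fun n ↦ integrable_finsetSum _ fun m _ ↦ (integrableOn_laguerreFn_mul_laguerreFn n m).const_mul _
  have hP2 : IntegrableOn (fun t ↦ P t ^ 2) (Ioi 0) := by
    have e : (fun t ↦ P t ^ 2) = fun t ↦ ∑ n ∈ range N, ∑ m ∈ range N,
        c n * c m * (laguerreFn n t * laguerreFn m t) := by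
      funext t; simp only [hP]; rw [sq, Finset.sum_mul_sum]
      exact Finset.sum_congr rfl fun n _ ↦ Finset.sum_congr rfl fun m _ ↦ by ring
    rw [e]; exact integrable_finsetSum _ fun n _ ↦ hPP n
  have h2' : ∫ t in Ioi (0 : ℝ), P t ^ 2 = S := by
    have e : (fun t ↦ P t ^ 2) = fun t ↦ ∑ n ∈ range N, ∑ m ∈ range N,
        c n * c m * (laguerreFn n t * laguerreFn m t) := by
      funext t; simp only [hP]; rw [sq, Finset.sum_mul_sum]
      exact Finset.sum_congr rfl fun n _ ↦ Finset.sum_congr rfl fun m _ ↦ by ring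
    rw [e, integral_finsetSum _ fun n _ ↦ hPP n]
    have e2 : ∀ n ∈ range N, (∫ t in Ioi (0 : ℝ), ∑ m ∈ range N,
        c n * c m * (laguerreFn n t * laguerreFn m t)) = c n ^ 2 := by
      intro n hn
      rw [integral_finsetSum _ fun m _ ↦ (integrableOn_laguerreFn_mul_laguerreFn n m).const_mul _]
      have e3 : ∀ m ∈ range N, (∫ t in Ioi (0 : ℝ), c n * c m * (laguerreFn n t * laguerreFn m t)) =
          c n * c m * (if n = m then 1 else 0) := by
        intro m _
        rw [integral_const_mul, integral_laguerreFn_mul_laguerreFn]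
      rw [Finset.sum_congr rfl e3]
      simp_rw [mul_ite, mul_one, mul_zero]
      rw [Finset.sum_ite_eq, if_pos hn]
      ring
    rw [Finset.sum_congr rfl e2]
  -- (3) `0 ≤ ∫ (h − P)² = ∫ h² − S`
  have h3 : ∫ t in Ioi (0 : ℝ), (h t - P t) ^ 2 = (∫ t in Ioi (0 : ℝ), h t ^ 2) - S := by
    have e : (fun t ↦ (h t - P t) ^ 2) = fun t ↦ (h t ^ 2 - 2 * (h t * P t)) + P t ^ 2 := by
      funext t; ring
    have hA : Integrable (fun t ↦ h t ^ 2 - 2 * (h t * P t)) (volume.restrict (Ioi 0)) :=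
      h2.sub (hhP.const_mul 2)
    rw [e, integral_add hA hP2, integral_sub h2 (hhP.const_mul 2), integral_const_mul, h1, h2']
    ring
  have h4 : 0 ≤ ∫ t in Ioi (0 : ℝ), (h t - P t) ^ 2 :=
    setIntegral_nonneg measurableSet_Ioi fun t _ ↦ sq_nonneg _
  rw [h3] at h4
  linarith

/-- Corollary: the Laguerre coefficients of such an `h` are square-summable.
[cite: AriasDeReyna2011KeiperLi, proof of Cor. 5.1 p.17] -/
theorem summable_sq_integral_mul_laguerreFn {h : ℝ → ℝ} (hm : AEStronglyMeasurable h (volume.restrict (Ioi 0)))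
    (h2 : IntegrableOn (fun t ↦ h t ^ 2) (Ioi 0)) :
    Summable (fun n : ℕ ↦ (∫ t in Ioi (0 : ℝ), h t * laguerreFn n t) ^ 2) := by
  refine summable_of_sum_range_le (c := ∫ t in Ioi (0 : ℝ), h t ^ 2) (fun n ↦ sq_nonneg _) ?_
  intro N
  exact sum_sq_integral_mul_laguerreFn_le hm h2 N

end LaguerreOrthogonality

end Literature.Analysis.SpecialFunctions
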